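import Literature.MathematicalPhysics.QuantumFieldTheory.Balaban1983to89.B6Prop22TwoLevelCensusUpTo
import Literature.MathematicalPhysics.QuantumFieldTheory.Balaban1983to89.B6Prop22HolderTwoLevelBoxRateUnif
import Literature.MathematicalPhysics.QuantumFieldTheory.Balaban1983to89.B6Prop22DualHolderTwoLevelBoxRateUnif

/-!
# `Balaban1983to89.B6Prop22TwoLevelCensusUnif` — [B6] PROPOSITION 2.2 IN ITS CENSUS TYPING `B6.Prop22Printed`, VERBATIM
# (both conjuncts, ONE threshold `M₁`, ONE rate `δ₀` for ALL Hölder exponents `0 ≤ α < 1`, the printed prefactors, the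
# realised multiscale distance (2.46)), INHABITED BY THE GENUINE TWO-LEVEL OPERATOR `G′ = (Δ^{ξ,N}_X + Q′*aQ′)⁻¹` ON THE
# FAMILY `TLIdx` OF ALL TWO-LEVEL NESTED GEOMETRIES (2.1)–(2.2) OF THE NEUMANN BOX — the first census-level instance of a
# [B6] proposition on a genuinely multi-level family; assembled from the `α`-uniform entry packages of the `_unif`
# re-threading (files 1–5) through gen 13's reduction edge `prop22Printed_twoLevel_of_holderUnif`

statement-level skeleton of published theorems with citation tags; proofs where landed; nothing here is a claim about the Yang–Mills mass gap

T. Bałaban, *Propagators and renormalization transformations for lattice gauge theories. II*, Commun. Math. Phys. **96**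
(1984) 223–250 [Balaban1984PropagatorsII]; [3] = *Regularity and decay of lattice Green's functions*, Commun. Math. Phys.
**89** (1983) 571–597 [Balaban1983RegularityDecay].  PDF held `paper:balaban1984-cmp96-propagators-rt-ii` (journal page =
PDF page + 222): p. 234 [PDF 12] (Prop. 2.2, (2.67)), p. 224 [PDF 2] ((2.1)–(2.2)), p. 231 [PDF 9] ((2.46)); [3] p. 573.

CITATION HEADER (lean-in-tree rule).  Cell `lit-balaban` (HOME `run/shared/lean/pub/lit-balaban/`), unit `lit-balaban-r03`
gen 13 (B6 fold owner, own lane), SKELETON row **B6.Prop2.2**.  File 6 (last) of the `_unif` re-threading: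
`…B4Lemma24HolderRateUnif` → `…B4Thm19ZeroBoxHolderRateUnif` / `…B4Thm19ZeroBoxHolderDualRateUnif` →
`…B6Prop22HolderTwoLevelBoxRateUnif` (`prop22_entry4_twoLevelBox_unif`) / `…B6Prop22DualHolderTwoLevelBoxRateUnif`
(`prop22_entry5_twoLevelBox_unif`); with p21's `α`-free entries 2, 3 (`…B6Prop22DerivTwoLevelBox.prop22_entry2_twoLevelBox`,
`…B6Prop22AdjTwoLevelBox.prop22_entry3_twoLevelBox`), this seat's census dictionary `…B6Prop22TwoLevelCensus` (`TLIdx`,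
`geo`, `gp`, `abs_sum_mul_le(2)`, `holder_pair_bound`, `prop22_supEntries_twoLevel`, `twoLevel_nonvacuous`) and the reduction
edge `…B6Prop22TwoLevelCensusUpTo.prop22Printed_twoLevel_of_holderUnif`.  Everything consumed BY NAME; nothing existing
modified; THEOREMS ONLY — no definition, no `def … : Prop` fact.

WHAT IS PRINTED (p. 234): «**Proposition 2.2.** If we have (2.1), (2.2) and M is sufficiently large, then the operator
G′ = Δ′_a^{−1} (a = 1) satisfies the inequalities |(G′λ)(x)|, |(∇G′λ)(x)|, |(G′∇*λ)(x)|, ‖ζ∇G′λ‖_α, ‖ζG′∇*λ‖_α, |(ΔG′λ)(x)|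
≤ O(1)[(L^jη)², L^jη, L^jη, (L^jη)^{1−α}(‖ζ‖_α + |ζ|), (L^jη)^{1−α}(‖ζ‖_α + |ζ|), 1]e^{−½δ₀d(y,y′)}|λ|, x ∈ B^j(y) or supp ζ ⊂
B^j(y), y ∈ Λ_j, supp λ ⊂ B^{j′}(y′), y′ ∈ Λ_{j′}. (2.67)»; the census module `…B6` types it as `B6.Prop22Printed geo Gp :=
∃ M₁ δ₀ C, ∃ Cα : ℝ → ℝ, 0 < M₁ ∧ 0 < δ₀ ∧ 0 < C ∧ ∀ i, Hyp21_22 → M₁ ≤ M → (four sup entries, C, pref4) ∧ (∀ α, 0 ≤ α →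
α < 1 → Hölder entries, Cα α)`.

WHAT THIS FILE PROVES (kernel-checked; 0 sorry; standard axioms):
* §1 `holderUnif_twoLevel` — THE `α`-UNIFORM HÖLDER PACKAGE on the two-level family: `∃ M₁ δ₀ > 0 ∀ α ∈ [0,1) ∃ C(α) ∀ i :
  TLIdx d ℓ, M₁ ≤ M → ∀ λ ζ y y′ (supp ζ ⊂ B(y), supp λ ⊂ B(y′)): max_μ max(‖ζ∇^ξ_μG′λ‖_α, ‖ζG′∇^{ξ*}_μλ‖_α) ≤
  C(α)·(L^jη)^{1−α}·(‖ζ‖_α + |ζ|)·e^{−½δ₀d(y,y′)}·|λ|` — gen 12's per-`α` argument (`prop22_holderEntries_twoLevel`) run on the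
  `α`-uniform entry packages: rates and thresholds of entries 2, 3, 4, 5 are combined by `min`/`+` BEFORE `α` is introduced
  (`wsum_mono`, `roww_mono`, `wsum2_mono_rate`), the constant after.
* §2 **`prop22Printed_twoLevel : B6.Prop22Printed (fun i : TLIdx d ℓ => i.geo) (fun i => i.gp)`** for every `d` and every
  `L = ℓ + 1 ≥ 2` — by `prop22Printed_twoLevel_of_holderUnif` (whose sup conjunct is gen 12's `prop22_supEntries_twoLevel`).
  `prop22Printed_twoLevel_nonvacuous` — the same together with gen 12's non-vacuity (`twoLevel_nonvacuous`: for every mesh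
  `k ≥ 1` and every threshold a member with `M ≥` threshold and blocks at BOTH levels), so the verbatim Prop is asserted on
  genuinely two-level multiscale geometries with `L^jη ∈ {1, L}` and the two-level distance (2.46), not on a degenerate
  sub-family.
HONEST SCOPE.  (1) The census Prop VERBATIM — but the honest scope of `…B6Prop22TwoLevelCensus` applies to the FAMILY:
TWO levels (`k`, `k+1`; print: `k + 1` levels `0 … k`), the Neumann box of `L`-blocks for `Ω₁ = … = Ω_k = X` (print
admits equal domains, p. 224; the torus is not treated), `A = 0`, `m² = 0`, printed weights `aPrinted` (a = 1), entry 3/5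
per component `μ`, forward differences along bonds of the box (`hqB`), realised distance (2.46) = graph distance of touching
blocks (reading R2, HOME/GAPS.md G-B6-22), constants existential (closed terms of the lineage's constants; `M₁`, `δ₀`, `C`
depend on `d`, `L`; `Cα` on `d`, `L`, `α`).  (2) `k`-level families (`…B6Prop22KLevelCensus`) have the sup conjunct
only; at kernel level the genuine `k`-level operator has entries 1, 2, 3, 6 (`…B6Prop22AllMultiLevelBox`) and, per `α`,
entry 4 (p21's `…B6Prop22HolderMultiLevelBox.prop22_fourth_multiLevelBox`) — entry 5, the `ζ`-dressing and the census
quantifier order on `k`-level families are not in the tree.  (3) No new estimate anywhere in files 1–6: the `α`-uniformity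
is the PRINTED quantifier order of [3] (1.9)/(2.36), realised by re-threading existing proofs.  NOT summit progress.
-/

noncomputable section

open scoped BigOperators
open Finset Matrix

namespace Literature.MathematicalPhysics.QuantumFieldTheory.Balaban1983to89.B6Prop22TwoLevelCensusUnif

open Literature.MathematicalPhysics.QuantumFieldTheory.Balaban1983to89.B4ContourShift (supNorm abs_le_supNorm supNorm_nonneg
  exists_supNorm_eq)
open Literature.MathematicalPhysics.QuantumFieldTheory.Balaban1983to89.B4Reflection242 (boxDom mem_boxDom blk)
open Literature.MathematicalPhysics.QuantumFieldTheory.Balaban1983to89.B4Thm110ZeroBox (roww)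
open Literature.MathematicalPhysics.QuantumFieldTheory.Balaban1983to89.B4Thm110ZeroBoxDeriv (wsum)
open Literature.MathematicalPhysics.QuantumFieldTheory.Balaban1983to89.B4Lemma22ZeroBoxDerivDual (fwd)
open Literature.MathematicalPhysics.QuantumFieldTheory.Balaban1983to89.B4Thm19ZeroBoxHolder (wsum2 wsum2_mono_rate)
open Literature.MathematicalPhysics.QuantumFieldTheory.Balaban1983to89.B4StripSumsHolder (one_le_supNorm)
open Literature.MathematicalPhysics.QuantumFieldTheory.Balaban1983to89.B6MultiLevelBoxOperator (N0 Domains aPrinted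
  aPrinted_window)
open Literature.MathematicalPhysics.QuantumFieldTheory.Balaban1983to89.B6Geom246MultiLevelBox (bset blkOf bond)
open Literature.MathematicalPhysics.QuantumFieldTheory.Balaban1983to89.B6Ineq243TwoLevelBox (gTwoLevel IsBlockUnion
  roww_mono wsum_mono)
open Literature.MathematicalPhysics.QuantumFieldTheory.Balaban1983to89.B6Ineq243AdjTwoLevelBox (dstar)
open Literature.MathematicalPhysics.QuantumFieldTheory.Balaban1983to89.B6Prop22DerivTwoLevelBox (prop22_entry2_twoLevelBox)
open Literature.MathematicalPhysics.QuantumFieldTheory.Balaban1983to89.B6Prop22AdjTwoLevelBox (prop22_entry3_twoLevelBox)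
open Literature.MathematicalPhysics.QuantumFieldTheory.Balaban1983to89.B6Prop22HolderTwoLevelBoxRateUnif
  (prop22_entry4_twoLevelBox_unif)
open Literature.MathematicalPhysics.QuantumFieldTheory.Balaban1983to89.B6Prop22DualHolderTwoLevelBoxRateUnif
  (prop22_entry5_twoLevelBox_unif)
open Literature.MathematicalPhysics.QuantumFieldTheory.Balaban1983to89.B6Prop22TwoLevelCensus (TLIdx
  prop22_supEntries_twoLevel twoLevel_nonvacuous)
open Literature.MathematicalPhysics.QuantumFieldTheory.Balaban1983to89.B6Prop22TwoLevelCensusUpTo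
  (prop22Printed_twoLevel_of_holderUnif)
open Literature.MathematicalPhysics.QuantumFieldTheory.Balaban1983to89.B6 (Geometry GpFamily Prop22Printed pref4)

variable {d ℓ : ℕ}

/-- matrix rows: `(Tλ)(x) = Σ_z T(x,z)λ(z)`. [folklore] -/
private theorem mulVec_eq_sum (i : TLIdx d ℓ) (T : Matrix ↥(i.XB) ↥(i.XB) ℝ) (f : ↥(i.XB) → ℝ) (x : ↥(i.XB)) :
    (T *ᵥ f) x = ∑ z, T x z * f z := rfl

/-- the weighted row functional `roww` of the lineage is the `wsum` of the row. [folklore] -/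
private theorem roww_eq_wsum (i : TLIdx d ℓ) (δ : ℝ) (T : Matrix ↥(i.XB) ↥(i.XB) ℝ) (x : ↥(i.XB)) :
    roww δ i.n T x = wsum δ i.n x (fun z => T x z) := rfl

/-- difference of two rows applied to `λ`. [folklore] -/
private theorem mulVec_sub_eq_sum (i : TLIdx d ℓ) (T : Matrix ↥(i.XB) ↥(i.XB) ℝ) (f : ↥(i.XB) → ℝ) (a b : ↥(i.XB))
    (c : ℝ) : c * ((T *ᵥ f) a - (T *ᵥ f) b) = ∑ z, (c * (T a z - T b z)) * f z := by
  simp only [mulVec_eq_sum, ← Finset.sum_sub_distrib, Finset.mul_sum]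
  refine Finset.sum_congr rfl fun z _ => ?_
  ring

/-- a weighted difference of two sums against `λ` is one sum. [folklore] -/
private theorem mul_sub_sum (i : TLIdx d ℓ) (c : ℝ) (a b f : ↥(i.XB) → ℝ) :
    c * (∑ z, a z * f z - ∑ z, b z * f z) = ∑ z, (c * (a z - b z)) * f z := by
  rw [← Finset.sum_sub_distrib, Finset.mul_sum]
  exact Finset.sum_congr rfl fun z _ => by ring

/-! ## §1 The `α`-uniform Hölder package on the two-level family -/

/-- **THE HÖLDER ENTRIES (2.67)₄,₅ ON THE GENUINE TWO-LEVEL FAMILY WITH ONE THRESHOLD AND ONE RATE FOR ALL `0 ≤ α < 1`**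
(the census order `∃ M₁ δ₀ ∀ α ∃ C(α)`): from the `α`-uniform entry packages `prop22_entry4_twoLevelBox_unif`,
`prop22_entry5_twoLevelBox_unif` and the `α`-free entries 2, 3 (`prop22_entry2_twoLevelBox`, `prop22_entry3_twoLevelBox` — the
sup of `F = ∇^ξ_μG′λ`, `G′∇^{ξ*}_μλ` on `B(y)`), with the rates combined by `min` and the thresholds by `+` BEFORE `α` is
fixed, then gen 12's conversions `abs_sum_mul_le`/`abs_sum_mul_le2` and the product rule `holder_pair_bound` at `α`.
[cite: Balaban1984PropagatorsII, Prop. 2.2 (2.67) p.234 (entries 4, 5); (2.46) p.231; p.232; Balaban1983RegularityDecay,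
Thm (1.9) p.573 («δ₀, c₀, R₀ … depending on d, M only, c₀ on α also»)] -/
theorem holderUnif_twoLevel (d ℓ : ℕ) (hℓ : 1 ≤ ℓ) :
    ∃ M₁ δ₀ : ℝ, 0 < M₁ ∧ 0 < δ₀ ∧ ∀ α : ℝ, 0 ≤ α → α < 1 → ∃ C : ℝ,
      ∀ i : TLIdx d ℓ, i.geo.Hyp21_22 → M₁ ≤ i.geo.M →
        ∀ (lam : i.geo.Loc) (ζ : i.geo.Cut) (y y' : i.geo.Site), i.geo.cutIn ζ y → i.geo.suppIn lam y' →
          i.gp.h1 lam α ζ ≤ C * (i.geo.len y) ^ (1 - α) * i.geo.cutH α ζ *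
            Real.exp (-(δ₀ / 2 * i.geo.dist y y')) * i.geo.supNorm lam := by
  classical
  set amin : ℝ := 1 - ((((ℓ : ℝ) + 1)) ^ 2)⁻¹ with hamin_def
  have hL2 : (1 : ℝ) < (((ℓ : ℝ) + 1)) ^ 2 := by
    have : (2 : ℝ) ≤ (ℓ : ℝ) + 1 := by
      have : (1 : ℝ) ≤ ℓ := by exact_mod_cast hℓ
      linarith
    nlinarith
  have hamin : 0 < amin := by
    rw [hamin_def, sub_pos]
    exact inv_lt_one_of_one_lt₀ hL2
  -- the four entry packages: 2, 3 (`α`-free), 4, 5 (`α`-uniform rate and threshold)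
  obtain ⟨δ₂, M₂, C₂, hδ₂, hM₂, hC₂, h2A⟩ := prop22_entry2_twoLevelBox d ℓ hℓ amin 1 0 1 1 hamin one_pos
  obtain ⟨δ₃, M₃, C₃, hδ₃, hM₃, hC₃, h3A⟩ := prop22_entry3_twoLevelBox d ℓ hℓ amin 1 0 1 1 hamin one_pos
  obtain ⟨δ₄, M₄, hδ₄, hM₄, h4U⟩ := prop22_entry4_twoLevelBox_unif d ℓ hℓ amin 1 0 1 1 hamin one_pos
  obtain ⟨δ₅, M₅, hδ₅, hM₅, h5U⟩ := prop22_entry5_twoLevelBox_unif d ℓ hℓ amin 1 0 1 1 hamin one_pos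
  set δA : ℝ := min (min δ₂ δ₃) (min δ₄ δ₅) with hδA_def
  have hδA : 0 < δA := lt_min (lt_min hδ₂ hδ₃) (lt_min hδ₄ hδ₅)
  have hd2 : δA ≤ δ₂ := (min_le_left _ _).trans (min_le_left _ _)
  have hd3 : δA ≤ δ₃ := (min_le_left _ _).trans (min_le_right _ _)
  have hd4 : δA ≤ δ₄ := (min_le_right _ _).trans (min_le_left _ _)
  have hd5 : δA ≤ δ₅ := (min_le_right _ _).trans (min_le_right _ _)
  set M0 : ℝ := M₂ + M₃ + M₄ + M₅ with hM0_def
  have hM0 : 0 < M0 := by positivity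
  refine ⟨max M0 (3 * ((ℓ : ℝ) + 1)), 2 * (δA / (d + 1)), lt_max_of_lt_left hM0, by positivity, ?_⟩
  intro α hα0 hα1
  obtain ⟨C₄, hC₄, h4A⟩ := h4U α hα0 hα1
  obtain ⟨C₅, hC₅, h5A⟩ := h5U α hα0 hα1
  set CA : ℝ := C₂ + C₃ + C₄ + C₅ with hCA_def
  have hCA : 0 < CA := by positivity
  refine ⟨CA * Real.exp δA, ?_⟩
  intro i _ hM lam ζ y y' hcut hsupp
  change ↥(i.XB) → ℝ at lam
  change ↥(i.XB) → ℝ at ζ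
  rw [TLIdx.geo_M] at hM
  have hM0' : M0 ≤ ((ℓ : ℝ) + 1) * i.Mh := le_trans (le_max_left _ _) hM
  have hm2 : M₂ ≤ ((ℓ : ℝ) + 1) * i.Mh := by linarith
  have hm3 : M₃ ≤ ((ℓ : ℝ) + 1) * i.Mh := by linarith
  have hm4 : M₄ ≤ ((ℓ : ℝ) + 1) * i.Mh := by linarith
  have hm5 : M₅ ≤ ((ℓ : ℝ) + 1) * i.Mh := by linarith
  have hMh3 : 3 ≤ i.Mh := by
    have h3 : 3 * ((ℓ : ℝ) + 1) ≤ ((ℓ : ℝ) + 1) * i.Mh := le_trans (le_max_right _ _) hM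
    have hL : (0 : ℝ) < (ℓ : ℝ) + 1 := by positivity
    have : (3 : ℝ) ≤ i.Mh := by nlinarith
    exact_mod_cast this
  obtain ⟨haj1, haj2, _⟩ := aPrinted_window hℓ one_pos i.hk
  rw [one_mul] at haj1
  have hP1 : ∀ μ, 1 ≤ (fun μ => (ℓ + 1) * i.P μ) μ :=
    fun μ => Nat.one_le_iff_ne_zero.2 (Nat.mul_ne_zero_iff.2 ⟨by omega, by have := i.hP μ; omega⟩)
  -- the four kernel-form bounds on the member's operator `i.G`, read at the common rate `δA`
  have h2' : ∀ (μ : Fin (d + 1)) (x xe : ↥(i.XB)), xe.1 = x.1 + Pi.single μ 1 →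
      wsum δA i.n x (fun z => ((i.n : ℕ) : ℝ) * (i.G xe z - i.G x z)) ≤ CA := by
    intro μ x xe hxe
    have h := h2A i.k i.hk (aPrinted ℓ 1 i.k) 0 1 haj1 haj2 le_rfl le_rfl le_rfl le_rfl i.Mh hMh3 hm2
      (fun μ => (ℓ + 1) * i.P μ) hP1 i.LamU i.isBlockUnion_LamU μ x xe hxe
    have h' := (wsum_mono hd2 _ _ _).trans h
    have : C₂ ≤ CA := by rw [hCA_def]; linarith
    exact h'.trans this
  have h3' : ∀ (μ : Fin (d + 1)) (x : ↥(i.XB)), roww δA i.n (dstar i.n μ i.G) x ≤ CA := by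
    intro μ x
    have h := h3A i.k i.hk (aPrinted ℓ 1 i.k) 0 1 haj1 haj2 le_rfl le_rfl le_rfl le_rfl i.Mh hMh3 hm3
      (fun μ => (ℓ + 1) * i.P μ) hP1 i.LamU i.isBlockUnion_LamU μ x
    have h' := (roww_mono hd3 _ _ _).trans h
    have : C₃ ≤ CA := by rw [hCA_def]; linarith
    exact h'.trans this
  have h4' : ∀ (μ : Fin (d + 1)) (x xe x' xe' : ↥(i.XB)), xe.1 = x.1 + Pi.single μ 1 → xe'.1 = x'.1 + Pi.single μ 1 →
      x'.1 ≠ x.1 → wsum2 δA i.n x x' (fun z => (((i.n : ℕ) : ℝ) / supNorm (x'.1 - x.1)) ^ α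
        * (((i.n : ℕ) : ℝ) * ((i.G xe' z - i.G x' z) - (i.G xe z - i.G x z)))) ≤ CA := by
    intro μ x xe x' xe' hxe hxe' hne
    have h := h4A i.k i.hk (aPrinted ℓ 1 i.k) 0 1 haj1 haj2 le_rfl le_rfl le_rfl le_rfl i.Mh hMh3 hm4
      (fun μ => (ℓ + 1) * i.P μ) hP1 i.LamU i.isBlockUnion_LamU μ x xe x' xe' hxe hxe' hne
    have h' := (wsum2_mono_rate hd4 _ _ _ _).trans h
    have : C₄ ≤ CA := by rw [hCA_def]; linarith
    exact h'.trans this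
  have h5' : ∀ (μ : Fin (d + 1)) (x x' : ↥(i.XB)), x'.1 ≠ x.1 →
      wsum2 δA i.n x x' (fun z => (((i.n : ℕ) : ℝ) / supNorm (x'.1 - x.1)) ^ α
        * (dstar i.n μ i.G x' z - dstar i.n μ i.G x z)) ≤ CA := by
    intro μ x x' hne
    have h := h5A i.k i.hk (aPrinted ℓ 1 i.k) 0 1 haj1 haj2 le_rfl le_rfl le_rfl le_rfl i.Mh hMh3 hm5
      (fun μ => (ℓ + 1) * i.P μ) hP1 i.LamU i.isBlockUnion_LamU μ x x' hne
    have h' := (wsum2_mono_rate hd5 _ _ _ _).trans h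
    have : C₅ ≤ CA := by rw [hCA_def]; linarith
    exact h'.trans this
  -- common shape of the target
  have hδ2 : 2 * (δA / (d + 1)) / 2 = δA / (d + 1) := by ring
  rw [hδ2, TLIdx.geo_supNorm]
  rw [TLIdx.geo_suppIn] at hsupp
  change ∀ w, ζ w ≠ 0 → i.blkD w = y at hcut
  change i.hH lam α ζ ≤ CA * Real.exp δA * (i.geo.len y) ^ (1 - α) * (i.hq α ζ + i.supF ζ) *
    Real.exp (-(δA / (d + 1) * i.geo.dist y y')) * i.supF lam
  set E : ℝ := Real.exp (-(δA / (d + 1) * i.geo.dist y y')) with hE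
  have hE0 : 0 ≤ E := (Real.exp_pos _).le
  have hS0 := i.supF_nonneg lam
  have hq0 := i.hq_nonneg α ζ
  have hz0 := i.supF_nonneg ζ
  have hpref : 1 ≤ (i.geo.len y) ^ (1 - α) := Real.one_le_rpow (i.one_le_len y) (by linarith)
  set B : ℝ := CA * Real.exp δA * E * i.supF lam with hB
  have hB0 : 0 ≤ B := by positivity
  have hfin : (i.hq α ζ + i.supF ζ) * B
      ≤ CA * Real.exp δA * (i.geo.len y) ^ (1 - α) * (i.hq α ζ + i.supF ζ) * E * i.supF lam := by
    have : (i.hq α ζ + i.supF ζ) * B * 1 ≤ (i.hq α ζ + i.supF ζ) * B * (i.geo.len y) ^ (1 - α) :=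
      mul_le_mul_of_nonneg_left hpref (by positivity)
    rw [hB] at this ⊢; linarith
  refine le_trans ?_ hfin
  have conv1 : ∀ (g : ↥(i.XB) → ℝ) (x : ↥(i.XB)), i.blkD x = y → wsum δA i.n x g ≤ CA →
      |∑ z, g z * lam z| ≤ B := by
    intro g x hx hg
    have h := i.abs_sum_mul_le hδA.le g lam x y' hsupp
    rw [hx] at h
    refine h.trans ?_
    have : Real.exp δA * E * wsum δA i.n x g * i.supF lam ≤ Real.exp δA * E * CA * i.supF lam :=
      mul_le_mul_of_nonneg_right (mul_le_mul_of_nonneg_left hg (by positivity)) hS0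
    rw [hB]; linarith
  have conv2 : ∀ (g : ↥(i.XB) → ℝ) (x x' : ↥(i.XB)), i.blkD x = y → i.blkD x' = y → wsum2 δA i.n x x' g ≤ CA →
      |∑ z, g z * lam z| ≤ B := by
    intro g x x' hx hx' hg
    have h := i.abs_sum_mul_le2 hδA.le g lam x x' y y' hx hx' hsupp
    refine h.trans ?_
    have : Real.exp δA * E * wsum2 δA i.n x x' g * i.supF lam ≤ Real.exp δA * E * CA * i.supF lam :=
      mul_le_mul_of_nonneg_right (mul_le_mul_of_nonneg_left hg (by positivity)) hS0
    rw [hB]; linarith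
  have hbound : i.hq α ζ * B + i.supF ζ * B = (i.hq α ζ + i.supF ζ) * B := by ring
  rw [← hbound]
  have hBB : 0 ≤ i.hq α ζ * B + i.supF ζ * B := by positivity
  refine i.hH_le_of_forall lam α ζ (fun μ => ?_) (fun μ => ?_)
  · -- entry 4: `ζ·∇^ξ_μG′λ`, bond pairs
    refine i.hqB_le_of_forall μ α _ hBB fun x x' hne hxm hxm' => ?_
    have hfx : (fwd i.NB μ x).1 = x.1 + Pi.single μ 1 := B4Lemma22ZeroBoxDerivDual.fwd_val_of_mem μ x hxm
    have hfx' : (fwd i.NB μ x').1 = x'.1 + Pi.single μ 1 := B4Lemma22ZeroBoxDerivDual.fwd_val_of_mem μ x' hxm'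
    refine i.holder_pair_bound α ζ (fun w => ((i.n : ℕ) : ℝ) * ((i.G *ᵥ lam) (fwd i.NB μ w) - (i.G *ᵥ lam) w)) y
      hcut x x' hne hB0 hB0 ?_ ?_ ?_
    · intro hx
      show |((i.n : ℕ) : ℝ) * ((i.G *ᵥ lam) (fwd i.NB μ x) - (i.G *ᵥ lam) x)| ≤ B
      rw [mulVec_sub_eq_sum]; exact conv1 _ x hx (h2' μ x _ hfx)
    · intro hx'
      show |((i.n : ℕ) : ℝ) * ((i.G *ᵥ lam) (fwd i.NB μ x') - (i.G *ᵥ lam) x')| ≤ B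
      rw [mulVec_sub_eq_sum]; exact conv1 _ x' hx' (h2' μ x' _ hfx')
    · intro hx hx'
      have hne' : x'.1 ≠ x.1 := fun h => hne (Subtype.ext h).symm
      show |((i.n : ℕ) : ℝ) * ((i.G *ᵥ lam) (fwd i.NB μ x') - (i.G *ᵥ lam) x')
          - ((i.n : ℕ) : ℝ) * ((i.G *ᵥ lam) (fwd i.NB μ x) - (i.G *ᵥ lam) x)| / (supNorm (x'.1 - x.1) / i.n) ^ α ≤ B
      rw [i.quot_eq_abs_weight α x x' hne', mulVec_sub_eq_sum, mulVec_sub_eq_sum, mul_sub_sum]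
      refine conv2 _ x x' hx hx' ((le_of_eq ?_).trans (h4' μ x _ x' _ hfx hfx' hne'))
      exact congrArg (wsum2 δA i.n x x') (funext fun z => by ring)
  · -- entry 5: `ζ·G′∇^{ξ*}_μλ`, site pairs
    refine i.hq_le_of_forall α _ hBB fun x x' hne => ?_
    refine i.holder_pair_bound α ζ (fun w => (dstar i.n μ i.G *ᵥ lam) w) y hcut x x' hne hB0 hB0 ?_ ?_ ?_
    · intro hx
      show |(dstar i.n μ i.G *ᵥ lam) x| ≤ B
      rw [mulVec_eq_sum]; exact conv1 _ x hx (by rw [← roww_eq_wsum]; exact h3' μ x)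
    · intro hx'
      show |(dstar i.n μ i.G *ᵥ lam) x'| ≤ B
      rw [mulVec_eq_sum]; exact conv1 _ x' hx' (by rw [← roww_eq_wsum]; exact h3' μ x')
    · intro hx hx'
      have hne' : x'.1 ≠ x.1 := fun h => hne (Subtype.ext h).symm
      show |(dstar i.n μ i.G *ᵥ lam) x' - (dstar i.n μ i.G *ᵥ lam) x| / (supNorm (x'.1 - x.1) / i.n) ^ α ≤ B
      rw [i.quot_eq_abs_weight α x x' hne', mulVec_eq_sum, mulVec_eq_sum, mul_sub_sum]
      exact conv2 _ x x' hx hx' (h5' μ x x' hne')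

/-! ## §2 `B6.Prop22Printed`, verbatim, on the genuine two-level family -/

/-- **PROPOSITION 2.2 OF [B6] IN ITS CENSUS TYPING, VERBATIM, INHABITED BY THE GENUINE TWO-LEVEL OPERATOR ON THE FAMILY OF
ALL TWO-LEVEL NESTED GEOMETRIES (2.1)–(2.2) OF THE NEUMANN BOX**: `B6.Prop22Printed (fun i : TLIdx d ℓ => i.geo) (fun i =>
i.gp)` for every dimension `d + 1` and every block size `L = ℓ + 1 ≥ 2` — ONE threshold «M sufficiently large», ONE rate
`δ₀` for the four sup entries AND for the Hölder entries at EVERY `0 ≤ α < 1` (`α`-dependent `C_α`), the printed prefactors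
`[(L^jη)², L^jη, L^jη, (L^jη)^{1−α}(‖ζ‖_α + |ζ|), (L^jη)^{1−α}(‖ζ‖_α + |ζ|), 1]`, the realised multiscale distance (2.46),
`G′ = (Δ^{ξ,N}_X + Q′*aQ′)⁻¹` with the printed weights.  By gen 13's reduction edge `prop22Printed_twoLevel_of_holderUnif`
applied to `holderUnif_twoLevel` (sup conjunct: gen 12's `prop22_supEntries_twoLevel`).
[cite: Balaban1984PropagatorsII, Prop. 2.2 (2.67) p.234; (2.1)–(2.2) p.224; (2.46) p.231] -/
theorem prop22Printed_twoLevel (d ℓ : ℕ) (hℓ : 1 ≤ ℓ) :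
    Prop22Printed (fun i : TLIdx d ℓ => i.geo) (fun i => i.gp) :=
  prop22Printed_twoLevel_of_holderUnif d ℓ hℓ (holderUnif_twoLevel d ℓ hℓ)

/-- **… AND NON-VACUOUSLY**: the verbatim Prop on the two-level family together with gen 12's witness that for every mesh
`k ≥ 1` and every threshold `M₁` the family has a member with `M ≥ M₁`, `Hyp21_22`, and blocks at BOTH levels `k` and
`k + 1`. [cite: Balaban1984PropagatorsII, Prop. 2.2 (2.67) p.234 («M is sufficiently large»); (2.1)–(2.2) p.224] -/
theorem prop22Printed_twoLevel_nonvacuous (d ℓ : ℕ) (hℓ : 1 ≤ ℓ) :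
    Prop22Printed (fun i : TLIdx d ℓ => i.geo) (fun i => i.gp) ∧
      ∀ (k : ℕ), 1 ≤ k → ∀ M₁ : ℝ, ∃ i : TLIdx d ℓ, i.k = k ∧ M₁ ≤ i.geo.M ∧ i.geo.Hyp21_22 ∧
        (∃ s : i.geo.Site, i.geo.scale s = k + 1) ∧ (∃ s : i.geo.Site, i.geo.scale s = k) :=
  ⟨prop22Printed_twoLevel d ℓ hℓ, fun k hk M₁ => twoLevel_nonvacuous d ℓ k hk M₁⟩

end Literature.MathematicalPhysics.QuantumFieldTheory.Balaban1983to89.B6Prop22TwoLevelCensusUnif
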